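import Mathlib.MeasureTheory.Measure.HasOuterApproxClosed
import Mathlib.MeasureTheory.Function.AEEqOfLIntegral
import Mathlib.MeasureTheory.Integral.Bochner.ContinuousLinearMap
import Mathlib.Topology.MetricSpace.Lipschitz
import Mathlib.Algebra.Order.Archimedean.Basic
import HarnessLib

/-!
# A measurable function is almost everywhere determined by the joint law of `(S, f S)`

Topic `Literature/Probability/Distributions`; glue of weak-convergence bookkeeping in the setting
of `JointLawClosedConstraint.lean` / `JointLawTruncatedLimitGlue.lean`, written for the limit
passage of TRANSLATION EQUIVARIANCE of the Garban–Pete–Schramm pivotal kernels of bond-`ℤ²`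
sublimits (route `Summits/CriticalPhenomena/CardyFormulaZ2/Theses/CardyMeckeFlip`, crux
`FlipErgodicityZ2`, stub `stub_equivariantVersion`, clause (ADM)(6)), but model-free.

**Setting.**  A finite Borel measure `μ` on a topological space `E` in which indicators of closed
sets are decreasing limits of bounded continuous functions (`HasOuterApproxClosed E`, e.g. every
pseudo-metrizable space), and two real-valued measurable functions `f, g : E → ℝ` (in the
application: the integrals of one test function against two measurable kernels `K S`, `K' S`).

**Results.**
* `ae_eq_comp_of_forall_integral_mul_eq` — if `∫ ψ(S) χ(f S) dμ = ∫ ψ(S) χ(g S) dμ` for every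
  bounded continuous `ψ` on `E`, for ONE continuous `χ : ℝ → [0, 1]`, then `χ ∘ f = χ ∘ g` almost
  everywhere (the finite measures `χ(f S) μ(dS)` and `χ(g S) μ(dS)` have the same integrals of
  bounded continuous functions, hence coincide — `ext_of_forall_integral_eq_of_IsFiniteMeasure` —
  and `withDensity` determines the density almost everywhere);
* `ae_eq_of_forall_integral_mul_eq` — **if the "joint laws" of `(S, f S)` and `(S, g S)` under `μ`
  agree on the product test functions `ψ(S) χ(r)`, `ψ` bounded continuous on `E` and `χ` ranging
  over the `1`-Lipschitz `[0,1]`-valued functions on `ℝ`, then `f = g` almost everywhere** (apply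
  the previous result to the countably many ramps `χ_q(r) = min 1 (max (r - q) 0)`, `q ∈ ℚ`, which
  separate the points of `ℝ`; no `def` is introduced for them);
* `ae_eq_of_forall_integral_pair_eq` — the same from equality of `∫ G(S, f S) dμ` and
  `∫ G(S, g S) dμ` for all bounded continuous `G` on `E × ℝ`.

Restricting the class of `χ` to Lipschitz functions is what makes the hypothesis checkable along
joint limits in law whose real coordinate is perturbed by a vanishing amount times a tight factor
(no uniform continuity in the real variable is then needed).  No named fact; Mathlib only.

## References

* P. Billingsley, *Convergence of Probability Measures*, 2nd ed. (1999), Thm. 1.2 (bounded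
  continuous functions determine a finite Borel measure on a metric space) — the only input.
-/

noncomputable section

open Set Filter
open _root_.MeasureTheory _root_.Topology
open scoped ENNReal NNReal BoundedContinuousFunction

namespace Literature.Probability.Distributions

/-! ### The separating ramps -/

/-- The unit ramps `χ_q(r) = min 1 (max (r - q) 0)` take values in `[0, 1]`. [folklore] -/
theorem unitRamp_mem_Icc (q r : ℝ) : min 1 (max (r - q) 0) ∈ Icc (0 : ℝ) 1 :=
  ⟨le_min zero_le_one (le_max_right _ _), min_le_left _ _⟩

/-- Translations of the line are `1`-Lipschitz. [folklore] -/
theorem lipschitzWith_sub_const (q : ℝ) : LipschitzWith 1 fun r : ℝ => r - q :=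
  LipschitzWith.of_dist_le_mul fun x y => by
    rw [NNReal.coe_one, one_mul]
    exact (dist_sub_right x y q).le

/-- The unit ramp `r ↦ min 1 (max (r - q) 0)` is `1`-Lipschitz. [folklore] -/
theorem lipschitzWith_unitRamp (q : ℝ) : LipschitzWith 1 fun r : ℝ => min 1 (max (r - q) 0) :=
  ((lipschitzWith_sub_const q).max_const 0).const_min 1

/-- The unit ramp vanishes to the left of `q`. [folklore] -/
theorem unitRamp_eq_zero_of_le {q r : ℝ} (h : r ≤ q) : min 1 (max (r - q) 0) = 0 := by
  rw [max_eq_right (sub_nonpos.2 h), min_eq_right zero_le_one]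

/-- The unit ramp is positive to the right of `q`. [folklore] -/
theorem unitRamp_pos_of_lt {q r : ℝ} (h : q < r) : 0 < min 1 (max (r - q) 0) :=
  lt_min zero_lt_one (lt_max_of_lt_left (sub_pos.2 h))

/-- **The rational unit ramps separate points**: two reals on which all the ramps
`min 1 (max (· - q) 0)`, `q ∈ ℚ`, agree are equal. [folklore] -/
theorem eq_of_forall_rat_unitRamp_eq {a b : ℝ}
    (h : ∀ q : ℚ, min 1 (max (a - q) 0) = min 1 (max (b - q) 0)) : a = b := by
  by_contra hab
  rcases lt_or_gt_of_ne hab with hlt | hlt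
  · obtain ⟨q, haq, hqb⟩ := exists_rat_btwn hlt
    have h1 := unitRamp_eq_zero_of_le haq.le
    have h2 := unitRamp_pos_of_lt hqb
    rw [← h q, h1] at h2
    exact lt_irrefl _ h2
  · obtain ⟨q, hbq, hqa⟩ := exists_rat_btwn hlt
    have h1 := unitRamp_eq_zero_of_le hbq.le
    have h2 := unitRamp_pos_of_lt hqa
    rw [h q, h1] at h2
    exact lt_irrefl _ h2

/-! ### One test function in the real variable -/

section OneChi

variable {E : Type*} [TopologicalSpace E] [MeasurableSpace E] [BorelSpace E]
  [HasOuterApproxClosed E] {μ : Measure E} [IsFiniteMeasure μ] {f g : E → ℝ}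

/-- **One `χ`: `χ ∘ f = χ ∘ g` almost everywhere.**  If for a continuous `χ : ℝ → [0,1]` and all
bounded continuous `ψ` on `E`, `∫ ψ(S) χ(f S) dμ = ∫ ψ(S) χ(g S) dμ`, then `χ (f S) = χ (g S)` for
`μ`-a.e. `S`: the finite measures with densities `χ ∘ f`, `χ ∘ g` have the same integrals of
bounded continuous functions, so they are equal (`ext_of_forall_integral_eq_of_IsFiniteMeasure`),
and equal `withDensity` measures have a.e. equal densities (`withDensity_eq_iff`). [folklore] -/
theorem ae_eq_comp_of_forall_integral_mul_eq (hf : Measurable f) (hg : Measurable g)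
    {χ : ℝ → ℝ} (hχ : Continuous χ) (hχ01 : ∀ r, χ r ∈ Icc (0 : ℝ) 1)
    (h : ∀ ψ : E →ᵇ ℝ, ∫ S, ψ S * χ (f S) ∂μ = ∫ S, ψ S * χ (g S) ∂μ) :
    (fun S => χ (f S)) =ᵐ[μ] fun S => χ (g S) := by
  -- the two densities
  set ρf : E → ℝ≥0∞ := fun S => ENNReal.ofReal (χ (f S)) with hρf
  set ρg : E → ℝ≥0∞ := fun S => ENNReal.ofReal (χ (g S)) with hρg
  have hρfm : Measurable ρf := ENNReal.measurable_ofReal.comp (hχ.measurable.comp hf)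
  have hρgm : Measurable ρg := ENNReal.measurable_ofReal.comp (hχ.measurable.comp hg)
  have hle : ∀ (k : E → ℝ) (S : E), ENNReal.ofReal (χ (k S)) ≤ 1 := fun k S => by
    rw [← ENNReal.ofReal_one]
    exact ENNReal.ofReal_le_ofReal (hχ01 _).2
  have hfin : ∀ k : E → ℝ, ∫⁻ S, ENNReal.ofReal (χ (k S)) ∂μ ≠ ∞ := fun k => by
    refine ne_top_of_le_ne_top (measure_ne_top μ univ) ?_
    calc ∫⁻ S, ENNReal.ofReal (χ (k S)) ∂μ ≤ ∫⁻ _, 1 ∂μ := lintegral_mono fun S => hle k S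
      _ = μ univ := by rw [lintegral_one]
  haveI : IsFiniteMeasure (μ.withDensity ρf) := isFiniteMeasure_withDensity (hfin f)
  haveI : IsFiniteMeasure (μ.withDensity ρg) := isFiniteMeasure_withDensity (hfin g)
  -- they define the same finite measure
  have heq : μ.withDensity ρf = μ.withDensity ρg := by
    refine ext_of_forall_integral_eq_of_IsFiniteMeasure fun ψ => ?_
    rw [integral_withDensity_eq_integral_toReal_smul hρfm
        (ae_of_all _ fun S => ENNReal.ofReal_lt_top),
      integral_withDensity_eq_integral_toReal_smul hρgm
        (ae_of_all _ fun S => ENNReal.ofReal_lt_top)]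
    have e : ∀ (k : E → ℝ) (S : E), (ENNReal.ofReal (χ (k S))).toReal • ψ S = ψ S * χ (k S) :=
      fun k S => by rw [ENNReal.toReal_ofReal (hχ01 _).1, smul_eq_mul, mul_comm]
    simp only [hρf, hρg, e]
    exact h ψ
  -- hence a.e. equal densities
  have hae : ρf =ᵐ[μ] ρg := (withDensity_eq_iff hρfm.aemeasurable hρgm.aemeasurable (hfin f)).1 heq
  filter_upwards [hae] with S hS
  have hS' : ENNReal.ofReal (χ (f S)) = ENNReal.ofReal (χ (g S)) := hS
  rwa [ENNReal.ofReal_eq_ofReal_iff (hχ01 _).1 (hχ01 _).1] at hS'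

end OneChi

/-! ### The determining statement -/

section Determining

variable {E : Type*} [TopologicalSpace E] [MeasurableSpace E] [BorelSpace E]
  [HasOuterApproxClosed E] {μ : Measure E} [IsFiniteMeasure μ] {f g : E → ℝ}

/-- **A measurable real function is a.e. determined by the "joint law" of `(S, f S)` tested on
products.**  If `∫ ψ(S) χ(f S) dμ = ∫ ψ(S) χ(g S) dμ` for all bounded continuous `ψ : E → ℝ` and all
`1`-Lipschitz `χ : ℝ → [0, 1]`, then `f = g` `μ`-almost everywhere (the rational unit ramps
`min 1 (max (· - q) 0)` are such `χ` and separate points; `ae_eq_comp_of_forall_integral_mul_eq`).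
[folklore] -/
theorem ae_eq_of_forall_integral_mul_eq (hf : Measurable f) (hg : Measurable g)
    (h : ∀ (ψ : E →ᵇ ℝ) (χ : ℝ → ℝ), LipschitzWith 1 χ → (∀ r, χ r ∈ Icc (0 : ℝ) 1) →
      ∫ S, ψ S * χ (f S) ∂μ = ∫ S, ψ S * χ (g S) ∂μ) :
    f =ᵐ[μ] g := by
  have hq : ∀ q : ℚ, (fun S => min 1 (max (f S - q) 0)) =ᵐ[μ] fun S => min 1 (max (g S - q) 0) :=
    fun q => ae_eq_comp_of_forall_integral_mul_eq hf hg (χ := fun r => min 1 (max (r - q) 0))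
      (lipschitzWith_unitRamp q).continuous (unitRamp_mem_Icc q)
      fun ψ => h ψ _ (lipschitzWith_unitRamp q) (unitRamp_mem_Icc q)
  filter_upwards [ae_all_iff.2 hq] with S hS
  exact eq_of_forall_rat_unitRamp_eq fun q => hS q

/-- **A measurable real function is a.e. determined by the joint law of `(S, f S)`**: if
`∫ G(S, f S) dμ = ∫ G(S, g S) dμ` for every bounded continuous `G : E × ℝ → ℝ`, then `f = g`
`μ`-almost everywhere. [folklore] -/
theorem ae_eq_of_forall_integral_pair_eq (hf : Measurable f) (hg : Measurable g)
    (h : ∀ G : E × ℝ →ᵇ ℝ, ∫ S, G (S, f S) ∂μ = ∫ S, G (S, g S) ∂μ) :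
    f =ᵐ[μ] g := by
  refine ae_eq_of_forall_integral_mul_eq hf hg fun ψ χ hχ hχ01 => ?_
  have hb : ∀ p : E × ℝ, ‖ψ p.1 * χ p.2‖ ≤ ‖ψ‖ * 1 := fun p => by
    rw [norm_mul]
    refine mul_le_mul (ψ.norm_coe_le_norm p.1) ?_ (norm_nonneg _) (norm_nonneg _)
    rw [Real.norm_eq_abs, abs_of_nonneg (hχ01 _).1]
    exact (hχ01 _).2
  set G : E × ℝ →ᵇ ℝ := BoundedContinuousFunction.ofNormedAddCommGroup
    (fun p : E × ℝ => ψ p.1 * χ p.2)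
    ((ψ.continuous.comp continuous_fst).mul (hχ.continuous.comp continuous_snd)) (‖ψ‖ * 1) hb
    with hG
  exact h G

end Determining

end Literature.Probability.Distributions

end
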